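import Summits.SmoothPoincare4.SmoothPoincare4.Theses.SullivanDual
import Literature.Geometry.Symplectic.GromovR4StdModel
import Literature.Geometry.Kaehler.ManifoldFormsChart
import Literature.Geometry.Kaehler.FormPullbackWithin
import Literature.Geometry.Kaehler.ManifoldFormsPullback

/-!
# SmoothPoincare4 / SullivanDual — crux `Target` (stmt-SmoothPoincare4-7823), stub `stub_formBound`

Chart-norm bound of a smooth `2`-form on a compact chart annulus of a punctured smooth
4-manifold.  Let `p ∈ M`, `e = extChartAt (𝓡 4) p`, and let `α` be a smooth `2`-form on the open
submanifold `M ∖ {p}` (`punctured p`).  If the closed chart-ball of radius `ε₃` about `e p` lies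
in the chart target and `0 < ε₀ ≤ ε₃`, then there is a constant `C` with
`|α_x(v, w)| ≤ C ‖De_x v‖ ‖De_x w‖` for every `x` in the chart source with
`ε₀ ≤ dist (e x) (e p) ≤ ε₃` and all tangent vectors `v, w` at `x`, where `De_x` is the
differential at `x` of `z ↦ e z.1` (the chart composed with the inclusion `M ∖ {p} → M`).

Proof.  Lift `e.symm` to a map `f : ℝ⁴ → M ∖ {p}` on the open set `s = e.target ∖ {e p}`; it is
`C^∞` on `s` (`contMDiffOn_extChartAt_symm` read through the open embedding `Subtype.val`).
The within-set pull-back `β = f^*_s α` (`MForm.pullbackWithin`) is continuous on `s`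
(`MForm.continuousOn_pullbackWithin`, Warner (1983), 2.22), hence bounded in operator norm on
the compact annulus `{ε₀ ≤ dist · (e p) ≤ ε₃} ⊆ s`.  Finally `f ∘ (e ∘ val) = id` near every
point of the punctured chart source, so by the chain rule `Df_{e x} ∘ De_x = id` and
`α_x(v, w) = β_{e x}(De_x v, De_x w)`, whence the bound by `‖β_{e x}‖ ≤ C`.

References: F. W. Warner, *Foundations of Differentiable Manifolds and Lie Groups*, GTM 94
(1983), 2.22 [WarnerGTM94].
-/

noncomputable section

-- the registered namespace `Summit.SmoothPoincare4.SmoothPoincare4.Theorems` repeats a component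
set_option linter.dupNamespace false

open scoped Manifold ContDiff Topology
open Set Filter Metric
open Literature.Geometry.Kaehler Literature.Geometry.Symplectic

namespace Summit.SmoothPoincare4.SmoothPoincare4.Theorems

namespace SullivanDual

variable {M : Type*} [TopologicalSpace M] [T2Space M] [ChartedSpace (EuclideanSpace ℝ (Fin 4)) M]
  [IsManifold (𝓡 4) ∞ M]

/-- **Stub C (chart-norm bound of a smooth `2`-form on a compact chart annulus).** A smooth
`2`-form `α` on `M ∖ {p}` is bounded, on the points of the chart source whose chart image lies in
the closed annulus `ε₀ ≤ ‖e x − e p‖ ≤ ε₃` (inside the chart target), by a constant times the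
product of the chart norms `‖De_x v‖ ‖De_x w‖` of its arguments (`De_x` the derivative of
`e ∘ Subtype.val` at `x`).  Reason: pulled back along the (lifted) inverse chart, the form reads
as a continuous map on the compact annulus, and `D(e.symm)_{e x} ∘ De_x = id`. [folklore] -/
theorem stub_formBound (p : M) (α : MForm (𝓡 4) (punctured p) ℝ 2) (hα : IsSmoothForm α)
    (ε₀ ε₃ : ℝ) (h₀ : 0 < ε₀) (h₀₃ : ε₀ ≤ ε₃)
    (hball : Metric.closedBall (extChartAt (𝓡 4) p p) ε₃ ⊆ (extChartAt (𝓡 4) p).target) :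
    ∃ C : ℝ, ∀ x : punctured p, x.1 ∈ (chartAt (EuclideanSpace ℝ (Fin 4)) p).source →
      ε₀ ≤ dist (extChartAt (𝓡 4) p x.1) (extChartAt (𝓡 4) p p) →
      dist (extChartAt (𝓡 4) p x.1) (extChartAt (𝓡 4) p p) ≤ ε₃ →
      ∀ v w : TangentSpace (𝓡 4) x,
        |α x ![v, w]| ≤ C *
          ‖(show EuclideanSpace ℝ (Fin 4) from mfderiv (𝓡 4) 𝓘(ℝ, EuclideanSpace ℝ (Fin 4))
              (fun z : punctured p => extChartAt (𝓡 4) p z.1) x v)‖ *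
          ‖(show EuclideanSpace ℝ (Fin 4) from mfderiv (𝓡 4) 𝓘(ℝ, EuclideanSpace ℝ (Fin 4))
              (fun z : punctured p => extChartAt (𝓡 4) p z.1) x w)‖ := by
  classical
  -- `h₀₃` is part of the registered signature but is not needed below: for `ε₃ < ε₀` the
  -- annulus is empty and the bound is vacuous
  have _ : ε₀ ≤ ε₃ := h₀₃
  -- the empty case is vacuous
  rcases isEmpty_or_nonempty (punctured p) with hE | ⟨⟨x₀⟩⟩
  · exact ⟨0, fun x => (IsEmpty.false x).elim⟩
  set e := extChartAt (𝓡 4) p with he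
  set c : EuclideanSpace ℝ (Fin 4) := e p with hc
  -- the open set `s = e.target \ {c}` and the lift `f` of `e.symm` to `punctured p`
  set s : Set (EuclideanSpace ℝ (Fin 4)) := e.target \ {c}
  have hs : IsOpen s := (isOpen_extChartAt_target (I := 𝓡 4) p).sdiff isClosed_singleton
  have hsp : ∀ y ∈ s, e.symm y ≠ p := by
    intro y hy h
    apply hy.2
    rw [mem_singleton_iff, hc, ← h, e.right_inv hy.1]
  set f : EuclideanSpace ℝ (Fin 4) → punctured p := fun y =>
    if h : e.symm y = p then x₀ else ⟨e.symm y, mem_punctured.2 h⟩ with hf_def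
  have hfval : ∀ y, e.symm y ≠ p → (f y).1 = e.symm y := by
    intro y hy
    simp only [hf_def, dif_neg hy]
  -- `f` is `C^∞` on `s`
  have h1 : ContMDiffOn 𝓘(ℝ, EuclideanSpace ℝ (Fin 4)) (𝓡 4) ∞ (Subtype.val ∘ f) s :=
    ((contMDiffOn_extChartAt_symm (I := 𝓡 4) (n := ∞) p).mono Set.sdiff_subset).congr
      fun y hy => hfval y (hsp y hy)
  have hfs : ContMDiffOn 𝓘(ℝ, EuclideanSpace ℝ (Fin 4)) (𝓡 4) ∞ f s := fun y hy =>
    (ContMDiffWithinAt.subtypeVal_comp_iff (punctured p) f s y).1 (h1 y hy)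
  -- the within-set pull-back `β = f^*_s α` is continuous on `s`
  set β := α.pullbackWithin f s with hβ_def
  have hβc : ContinuousOn β s :=
    MForm.continuousOn_pullbackWithin hs.uniqueDiffOn hfs
      fun y _ => (isSmoothForm_iff_smoothAt α).1 hα (f y)
  -- the compact annulus `A ⊆ s`
  set A : Set (EuclideanSpace ℝ (Fin 4)) := closedBall c ε₃ ∩ (ball c ε₀)ᶜ
  have hA : IsCompact A := (isCompact_closedBall c ε₃).inter_right isOpen_ball.isClosed_compl
  have hAs : A ⊆ s := by
    rintro y ⟨hy₁, hy₂⟩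
    refine ⟨hball hy₁, fun hy => hy₂ ?_⟩
    rw [mem_singleton_iff.1 hy]
    exact mem_ball_self h₀
  obtain ⟨C, hC⟩ := hA.exists_bound_of_continuousOn (hβc.mono hAs)
  -- `f ∘ (e ∘ val) = id` on the punctured chart source
  have hfx : ∀ z : punctured p, z.1 ∈ (chartAt (EuclideanSpace ℝ (Fin 4)) p).source →
      f (e z.1) = z := by
    intro z hz
    have hsrc : z.1 ∈ e.source := by rw [he, extChartAt_source]; exact hz
    have h2 : e.symm (e z.1) = z.1 := e.left_inv hsrc
    have h3 : e.symm (e z.1) ≠ p := by rw [h2]; exact mem_punctured.1 z.2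
    exact Subtype.ext ((hfval _ h3).trans h2)
  -- transport of the evaluation along an equality of base points
  have key : ∀ x x' : punctured p, x' = x → ∀ u : Fin 2 → EuclideanSpace ℝ (Fin 4),
      α x' u = α x u := by
    rintro x x' rfl u
    rfl
  -- smoothness of `z ↦ e z.1` on the open punctured chart source
  have hU₀ : IsOpen {z : punctured p | z.1 ∈ (chartAt (EuclideanSpace ℝ (Fin 4)) p).source} :=
    continuous_subtype_val.isOpen_preimage _ (chartAt (EuclideanSpace ℝ (Fin 4)) p).open_source
  have hE : ContMDiffOn (𝓡 4) 𝓘(ℝ, EuclideanSpace ℝ (Fin 4)) ∞ (fun z : punctured p => e z.1)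
      {z : punctured p | z.1 ∈ (chartAt (EuclideanSpace ℝ (Fin 4)) p).source} :=
    (contMDiffOn_extChartAt (I := 𝓡 4) (x := p) (n := ∞)).comp
      (contMDiff_subtype_val (I := 𝓡 4) (n := ∞) (U := punctured p)).contMDiffOn
      (fun z hz => hz)
  refine ⟨C, ?_⟩
  intro x hxs hlo hhi v w
  -- the chart point `y = e x.1` lies in the annulus
  have hyA : e x.1 ∈ A :=
    ⟨mem_closedBall.2 hhi, fun h => not_lt.2 hlo (mem_ball.1 h)⟩
  have hys : e x.1 ∈ s := hAs hyA
  -- derivatives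
  have hEx : MDifferentiableAt (𝓡 4) 𝓘(ℝ, EuclideanSpace ℝ (Fin 4))
      (fun z : punctured p => e z.1) x :=
    (hE x hxs).mdifferentiableWithinAt (by simp) |>.mdifferentiableAt (hU₀.mem_nhds hxs)
  have hfy : MDifferentiableAt 𝓘(ℝ, EuclideanSpace ℝ (Fin 4)) (𝓡 4) f (e x.1) :=
    ((hfs _ hys).contMDiffAt (hs.mem_nhds hys)).mdifferentiableAt (by simp)
  have hcomp := hfy.hasMFDerivAt.comp x hEx.hasMFDerivAt
  have hev : (id : punctured p → punctured p) =ᶠ[𝓝 x] (f ∘ fun z : punctured p => e z.1) := by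
    filter_upwards [hU₀.mem_nhds hxs] with z hz
    exact (hfx z hz).symm
  have hid := hcomp.congr_of_eventuallyEq hev
  have hDD := hasMFDerivAt_unique hid (hasMFDerivAt_id (I := 𝓡 4) x)
  have hDv : ∀ u : TangentSpace (𝓡 4) x,
      mfderivWithin 𝓘(ℝ, EuclideanSpace ℝ (Fin 4)) (𝓡 4) f s (e x.1)
        (mfderiv (𝓡 4) 𝓘(ℝ, EuclideanSpace ℝ (Fin 4)) (fun z : punctured p => e z.1) x u) = u := by
    intro u
    have h := ContinuousLinearMap.ext_iff.1 hDD u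
    rw [ContinuousLinearMap.comp_apply, ← mfderivWithin_of_isOpen hs hys] at h
    exact h
  -- the key identity `α x (v, w) = β (e x) (De v, De w)`
  have hβx : β (e x.1)
      ![mfderiv (𝓡 4) 𝓘(ℝ, EuclideanSpace ℝ (Fin 4)) (fun z : punctured p => e z.1) x v,
        mfderiv (𝓡 4) 𝓘(ℝ, EuclideanSpace ℝ (Fin 4)) (fun z : punctured p => e z.1) x w] =
      α x ![v, w] := by
    rw [hβ_def, MForm.pullbackWithin_apply, key x (f (e x.1)) (hfx x hxs)]
    congr 1
    funext i
    fin_cases i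
    · simp only [Fin.zero_eta, Fin.isValue, Matrix.cons_val_zero, hDv]
    · simp only [Fin.mk_one, Fin.isValue, Matrix.cons_val_one, Matrix.cons_val_zero, hDv]
  -- the bound
  have hop := (β (e x.1)).le_opNorm
    ![mfderiv (𝓡 4) 𝓘(ℝ, EuclideanSpace ℝ (Fin 4)) (fun z : punctured p => e z.1) x v,
      mfderiv (𝓡 4) 𝓘(ℝ, EuclideanSpace ℝ (Fin 4)) (fun z : punctured p => e z.1) x w]
  simp only [Fin.prod_univ_two, Fin.isValue, Matrix.cons_val_zero, Matrix.cons_val_one] at hop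
  rw [hβx, Real.norm_eq_abs] at hop
  calc |α x ![v, w]|
      ≤ ‖β (e x.1)‖ *
          (‖(show EuclideanSpace ℝ (Fin 4) from mfderiv (𝓡 4) 𝓘(ℝ, EuclideanSpace ℝ (Fin 4))
              (fun z : punctured p => e z.1) x v)‖ *
            ‖(show EuclideanSpace ℝ (Fin 4) from mfderiv (𝓡 4) 𝓘(ℝ, EuclideanSpace ℝ (Fin 4))
              (fun z : punctured p => e z.1) x w)‖) := hop
    _ ≤ C *
          (‖(show EuclideanSpace ℝ (Fin 4) from mfderiv (𝓡 4) 𝓘(ℝ, EuclideanSpace ℝ (Fin 4))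
              (fun z : punctured p => e z.1) x v)‖ *
            ‖(show EuclideanSpace ℝ (Fin 4) from mfderiv (𝓡 4) 𝓘(ℝ, EuclideanSpace ℝ (Fin 4))
              (fun z : punctured p => e z.1) x w)‖) :=
        mul_le_mul_of_nonneg_right (hC _ hyA) (mul_nonneg (norm_nonneg _) (norm_nonneg _))
    _ = _ := by ring

end SullivanDual

end Summit.SmoothPoincare4.SmoothPoincare4.Theorems

end
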